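import Summits.CriticalPhenomena.CardyFormulaZ2.Theses.CardySelfRefinement
import Literature.Probability.RandomPlanarGeometry.SLEUniquenessInLaw

/-!
# `CardySelfRefinement.SubseqUpgrade` (item stmt-CriticalPhenomena-10279) — proved

Route `CardySelfRefinement` (route-CriticalPhenomena-CardySelfRefinement), sub-problem
`CardyFormulaZ2`, item `Summit.CriticalPhenomena.CardyFormulaZ2.Theses.CardySelfRefinement.SubseqUpgrade`
(the subsequence principle, rank 9):

  (H1) for every Dobrushin domain `D` and admissible ℤ²-discretisation family `E`, the bond
       interface `bondInterfaceIn D (E δ)` is eventually (δ → 0⁺) a.e.-measurable; and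
  (H2) along every everywhere-positive null sequence of meshes there are ONE strictly increasing
       subsequence `φ` and ONE chordal family `P` of chordal SLE₆ laws such that, for all `(D, E)`
       at once, the interface laws at meshes `δs (φ n)` converge (bounded continuous test
       functions) to `P D`;
  ⟹  for every `(D, E)`: `ConvergesInLawToSLE 6 D (bondInterfaceIn D (E ·)) (bondPercolation …)`.

This file is the sorry-free build of the crux line `uniqueness-pin-subsequence`
(`Cruxes/SubseqUpgrade/Lines/uniqueness-pin-subsequence.lean`, skeleton sha `9603d8e8…`,
registered stubs `stub_uniquenessPin`, `stub_lawCriterion`), with the two registered stubs PROVED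
under their registered names and signatures and the registered composition `SubseqUpgrade_of`
concluding the route declaration by name.

## The proof in one paragraph

LEVER: uniqueness of the chordal SLE_κ law of a Dobrushin domain (`IsSLELaw.unique'`, a tree
THEOREM via `IsSLECurve.map_eq_holds`, `Literature/Probability/RandomPlanarGeometry/SLEUniquenessInLaw.lean`)
PINS every subsequential limit law produced by (H2) — whatever the mesh sequence, whatever the
subsequence — to the law `preWienerMeasure.map Γ` of ONE SLE_κ random curve `Γ` that (H2) itself
hands over along the harmonic sequence `1/(n+1)` (`stub_uniquenessPin`). With the limit pinned,
the subsequence principle on the countably generated filter `𝓝[>] 0`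
(`Filter.tendsto_of_subseq_tendsto`), one bounded continuous test function at a time and after an
index shift `n ↦ n + N` making an eventually-positive sequence everywhere positive, IS
`TendstoLaw` (`stub_lawCriterion`), i.e. the third clause of `ConvergesInLawToSLE`; (H1) is its
second clause verbatim and `Γ` its first (`sleCriterion`, the model-free, κ-general transfer).
`SubseqUpgrade_of` specialises the transfer at `κ = 6`, `Ωδ := fun _ ↦ BondConfig (Site 2)`,
`Y δ := bondInterfaceIn D (E δ)`, `P δ := bondPercolation (zdGraph 2) half`; the uniform-in-`(D,E)`
subsequence/family of (H2) is used only through its `D`-component.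

## What is load-bearing (standing Disproof, `Cruxes/SubseqUpgrade/Disproof.lean`; landed
`Theorems/SubseqUpgrade/Negative/SubseqPrincipleNeedsUniqueness.lean`, p76998)

`not_subseq_principle_pair` / `subseq_principle_of_subsingleton`: with a two-point target set the
subsequence principle FAILS, so identification of the subsequential limits up to uniqueness is
THE load-bearing input — honoured at `stub_uniquenessPin` (`IsSLELaw.unique'`);
`stub_lawCriterion` is stated for a FIXED limit `Z`. Not load-bearing (and not used): one `φ` /
one family for all `(D, E)`, `StrictMono φ` (cf. `convergesInLawToSLE_of_subseq` there).

Sources: Billingsley (1999), *Convergence of Probability Measures*, Thm. 2.6 (subsequence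
criterion for weak convergence); Lawler (2005), *Conformally Invariant Processes in the Plane*,
§6.1, §6.3 (the chordal SLE_κ law of `(D; a, b)` is well defined); Schramm (2000), §1.
No new definitions; axioms `propext`, `Classical.choice`, `Quot.sound`.
-/

open Filter Topology MeasureTheory
open scoped NNReal BoundedContinuousFunction
open Literature.Probability.RandomPlanarGeometry

namespace Summit.CriticalPhenomena.CardyFormulaZ2.Cruxes.SubseqUpgrade.UniquenessPinSubsequence

/-! ### The two registered stubs, proved (names and signatures as registered on the item) -/

/-- **`stub_uniquenessPin` — the uniqueness pin** (the load-bearing step). For every `κ`, every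
Dobrushin domain `D` and every mesh-indexed family of random curve classes
`Y δ : Ωδ δ → CurveClass ℂ` with laws `P δ`: if along every everywhere-positive null sequence of
meshes some strictly increasing subsequence converges, against bounded continuous test functions,
to SOME chordal SLE_κ law of `(D; a, b)`, then there is ONE chordal SLE_κ random curve `Γ` in `D`
such that along every such sequence some strictly increasing subsequence converges to the law of
`Γ`. Proof: apply the hypothesis to `s = 1/(n+1)` and open `IsSLELaw κ D μ₀` to get `Γ`; for any
`s`, the limit law `μ` handed out by the hypothesis equals `preWienerMeasure.map Γ` by uniqueness
of the chordal SLE_κ law (`IsSLELaw.unique'`, `IsSLECurve.isSLELaw_map`); rewrite `∫ f dμ` by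
`MeasureTheory.integral_map`. Lawler (2005), §6.1, §6.3; Rohde–Schramm (2005), Prop. 2.1 (i). -/
theorem stub_uniquenessPin :
    ∀ (κ : ℝ≥0) (D : DobrushinDomain) {Ωδ : ℝ → Type} [∀ δ, MeasurableSpace (Ωδ δ)]
      (Y : ∀ δ, Ωδ δ → CurveClass ℂ) (P : ∀ δ, Measure (Ωδ δ)),
      (∀ s : ℕ → ℝ, (∀ n, 0 < s n) → Tendsto s atTop (𝓝 0) →
          ∃ φ : ℕ → ℕ, StrictMono φ ∧ ∃ μ : Measure (CurveClass ℂ), IsSLELaw κ D μ ∧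
            ∀ f : CurveClass ℂ →ᵇ ℝ,
              Tendsto (fun n ↦ ∫ ω, f (Y (s (φ n)) ω) ∂P (s (φ n))) atTop (𝓝 (∫ x, f x ∂μ))) →
        ∃ Γ : (ℝ≥0 → ℝ) → CurveClass ℂ, IsSLECurve κ D Γ ∧
          ∀ s : ℕ → ℝ, (∀ n, 0 < s n) → Tendsto s atTop (𝓝 0) →
            ∃ φ : ℕ → ℕ, StrictMono φ ∧ ∀ f : CurveClass ℂ →ᵇ ℝ,
              Tendsto (fun n ↦ ∫ ω, f (Y (s (φ n)) ω) ∂P (s (φ n))) atTop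
                (𝓝 (∫ ω, f (Γ ω) ∂Literature.Probability.Process.preWienerMeasure)) := by
  intro κ D Ωδ _ Y P h
  -- one SLE_κ random curve `Γ` in `D`, from the hypothesis along the harmonic sequence
  obtain ⟨-, -, μ₀, ⟨Γ, hΓ, -⟩, -⟩ :=
    h (fun n ↦ 1 / ((n : ℝ) + 1)) (fun n ↦ Nat.one_div_pos_of_nat)
      tendsto_one_div_add_atTop_nhds_zero_nat
  refine ⟨Γ, hΓ, fun s hs hs0 ↦ ?_⟩
  obtain ⟨φ, hφ, μ, hμ, hlim⟩ := h s hs hs0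
  refine ⟨φ, hφ, fun f ↦ ?_⟩
  -- the limit law is THE SLE_κ law of `(D; a, b)`, i.e. the law of `Γ`
  have hμeq : μ = Literature.Probability.Process.preWienerMeasure.map Γ :=
    hμ.unique' hΓ.isSLELaw_map
  have hl := hlim f
  rw [hμeq, integral_map hΓ.aemeasurable f.continuous.aestronglyMeasurable] at hl
  exact hl

/-- **`stub_lawCriterion` — the shifted subsequence principle for `TendstoLaw`** (SLE-free; any
configuration spaces `Ωδ δ`, any target space `X`, any limit variable `Z` under `P'`): if along
every everywhere-positive null sequence of meshes some strictly increasing subsequence of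
`δ ↦ ∫ f (Y δ ·) dP δ` converges to `∫ f (Z ·) dP'` for every bounded continuous `f`, then
`Y δ → Z` in law along `𝓝[>] 0` (`TendstoLaw`). Proof: fix `f`; `Filter.tendsto_of_subseq_tendsto`
on `𝓝[>] 0` (countably generated); a sequence `s → 0` within `Ioi 0` tends to `0`
(`tendsto_nhds_of_tendsto_nhdsWithin`) and is positive from some index `N` on
(`tendsto_nhdsWithin_iff`, `Filter.eventually_atTop`); apply the hypothesis to `n ↦ s (n + N)`
(`Filter.tendsto_add_atTop_nat`) and return the reindexing `n ↦ φ n + N`.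
Billingsley (1999), Thm. 2.6. -/
theorem stub_lawCriterion :
    ∀ {Ωδ : ℝ → Type} [∀ δ, MeasurableSpace (Ωδ δ)] {Ω' : Type} [MeasurableSpace Ω']
      {X : Type} [TopologicalSpace X]
      (Y : ∀ δ, Ωδ δ → X) (P : ∀ δ, Measure (Ωδ δ)) (Z : Ω' → X) (P' : Measure Ω'),
      (∀ s : ℕ → ℝ, (∀ n, 0 < s n) → Tendsto s atTop (𝓝 0) →
          ∃ φ : ℕ → ℕ, StrictMono φ ∧ ∀ f : X →ᵇ ℝ,
            Tendsto (fun n ↦ ∫ ω, f (Y (s (φ n)) ω) ∂P (s (φ n))) atTop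
              (𝓝 (∫ ω, f (Z ω) ∂P'))) →
        TendstoLaw Y P Z P' := by
  intro Ωδ _ Ω' _ X _ Y P Z P' h f
  refine tendsto_of_subseq_tendsto fun s hs ↦ ?_
  have hs0 : Tendsto s atTop (𝓝 0) := tendsto_nhds_of_tendsto_nhdsWithin hs
  obtain ⟨N, hN⟩ := eventually_atTop.1 (tendsto_nhdsWithin_iff.1 hs).2
  -- shift the index so that the sequence is positive, then apply the hypothesis
  obtain ⟨φ, -, hlim⟩ := h (fun n ↦ s (n + N)) (fun n ↦ hN _ (N.le_add_left n))
    (hs0.comp (tendsto_add_atTop_nat N))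
  exact ⟨fun n ↦ φ n + N, hlim f⟩

/-! ### Transfer C⁺ (model-free, any `κ`): the two stubs give the convergence criterion -/

/-- **Convergence in law to chordal SLE_κ from subsequential identification alone** (the line's
transfer C⁺; Prokhorov-free sibling of `convergesInLawToSLE_of_isTightAlongMesh'`): for every
`κ`, `D`, configuration spaces `Ωδ`, random curve classes `Y δ` with laws `P δ`, eventual
a.e.-measurability plus "every everywhere-positive null sequence of meshes has a strictly
increasing subsequence along which the laws converge to SOME chordal SLE_κ law of `(D; a, b)`"
gives `ConvergesInLawToSLE κ D Y P`. Pure logic from the two stubs: the pin supplies `Γ` with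
`IsSLECurve κ D Γ` and per-sequence subsequential convergence to the law of `Γ`; the law criterion
turns the latter into `TendstoLaw Y P Γ preWienerMeasure`; measurability is carried verbatim.
Billingsley (1999), Thm. 2.6; Lawler (2005), §6.3. -/
theorem sleCriterion (κ : ℝ≥0) (D : DobrushinDomain) {Ωδ : ℝ → Type}
    [∀ δ, MeasurableSpace (Ωδ δ)] (Y : ∀ δ, Ωδ δ → CurveClass ℂ) (P : ∀ δ, Measure (Ωδ δ))
    (hY : ∀ᶠ δ in 𝓝[>] (0 : ℝ), AEMeasurable (Y δ) (P δ))
    (h : ∀ s : ℕ → ℝ, (∀ n, 0 < s n) → Tendsto s atTop (𝓝 0) →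
        ∃ φ : ℕ → ℕ, StrictMono φ ∧ ∃ μ : Measure (CurveClass ℂ), IsSLELaw κ D μ ∧
          ∀ f : CurveClass ℂ →ᵇ ℝ,
            Tendsto (fun n ↦ ∫ ω, f (Y (s (φ n)) ω) ∂P (s (φ n))) atTop (𝓝 (∫ x, f x ∂μ))) :
    ConvergesInLawToSLE κ D Y P := by
  obtain ⟨Γ, hΓ, hconv⟩ := stub_uniquenessPin κ D Y P h
  exact ⟨Γ, hΓ, hY, stub_lawCriterion Y P Γ Literature.Probability.Process.preWienerMeasure hconv⟩

/-! ### The composition: the crux, by name -/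

/-- **The crux `CardySelfRefinement.SubseqUpgrade` holds** (the registered composition of line
`uniqueness-pin-subsequence`, now hypothesis-free since both stubs are proved above). Specialise
the transfer `sleCriterion` at `κ = 6`, `Ωδ := fun _ ↦ BondConfig (Site 2)`,
`Y δ := bondInterfaceIn D (E δ)`, `P δ := bondPercolation (zdGraph 2) half`; (H1) at `(D, E)` is
the measurability input; (H2) at the sequence `s` gives `φ`, the family `P_fam` with
`IsSLELaw 6 D (P_fam D)` and the convergence at `(D, E)` — only the `D`-component is used.
Billingsley (1999), Thm. 2.6; Lawler (2005), §6.1, §6.3. -/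
theorem SubseqUpgrade_of :
    Summit.CriticalPhenomena.CardyFormulaZ2.Theses.CardySelfRefinement.SubseqUpgrade := by
  unfold Summit.CriticalPhenomena.CardyFormulaZ2.Theses.CardySelfRefinement.SubseqUpgrade
  rintro ⟨hmeas, hsub⟩ D E hE
  refine sleCriterion 6 D _ _ (hmeas D E hE) fun s hs hs0 ↦ ?_
  obtain ⟨φ, hφ, Pfam, hP, hlim⟩ := hsub s hs hs0
  exact ⟨φ, hφ, Pfam D, hP D, hlim D E hE⟩

end Summit.CriticalPhenomena.CardyFormulaZ2.Cruxes.SubseqUpgrade.UniquenessPinSubsequence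

namespace Summit.CriticalPhenomena.CardyFormulaZ2.Theorems

/-- **Item stmt-CriticalPhenomena-10279 closed**: `CardySelfRefinement.SubseqUpgrade`, by the
composition `SubseqUpgrade_of` of line `uniqueness-pin-subsequence` (uniqueness pin
`IsSLELaw.unique'` + subsequence criterion `Filter.tendsto_of_subseq_tendsto` on `𝓝[>] 0`).
Billingsley (1999), Thm. 2.6; Lawler (2005), §6.1, §6.3. -/
theorem subseqUpgrade_proof :
    Summit.CriticalPhenomena.CardyFormulaZ2.Theses.CardySelfRefinement.SubseqUpgrade :=
  Summit.CriticalPhenomena.CardyFormulaZ2.Cruxes.SubseqUpgrade.UniquenessPinSubsequence.SubseqUpgrade_of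

end Summit.CriticalPhenomena.CardyFormulaZ2.Theorems
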